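import Summits.QuantumFields.YangMills.Theorems.UnitScaleTiltProp7GreenOnPureGaugeSources
import Summits.QuantumFields.YangMills.Theorems.UnitScaleTiltProp7RieszTauFrobNormT3
import HarnessLib

/-!
# Route `UnitScaleTilt`, crux K1 «MinimiserStabilityRegPr» (stmt-QuantumFields-19200), EX row (5) `norm_G`, letter `h3` = STOREY H, H-ROAD bricks **H1 + H3 (= (B1) + (B3) of
# 19200 evidence #56 `LOCATE-Hess3-LIT-px13g16.md`): THE VALUE ROWS OF STOREY H's SCALAR OBJECTS** — for the third word of `𝔊`, `u := λ₁ = G′ᴾ_a(R_S(D*_{U₀}(G_{Δx} x)))`,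
# `ω := ω₁ = R_S(D*_{U₀}(G_{Δx} x))`, `x = toL2 A`: the sups `N_ω` of `ω₁`, `M_u` of `λ₁`, `M_w` of `D_{U₀}λ₁`, ALL LINEAR IN `‖A‖`, from the divergence sup row of `G_{Δx}` ((Div1):
# px17 ✓`Prop7H1GradientRowOfLetters` `hD1` text ∕ FILE C ✓`valueDiv_rows_GTpi_of_letters`' output ∕ ✓`Prop7OneFormGreenSupRowsOfBlockRows`), the `R_S` sup letter ((c1) of px5's
# ✓`Prop7GaugeProjectorSupPackage.norm_equiv_RS_le_of_letters` ∕ `…Pin.norm_equiv_RS_le_pin`, text VERBATIM) and the scalar-storey sup letters (c1)(c2) of FILE C (texts VERBATIM);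
# plus the slice-engine equation `Δ^η_{U₀}λ₁ = ω₁` (✓`Prop7GreenOnPureGaugeSources.covLapSite_GprimeP_RS`).  Outputs in BOTH currencies: the route's `toL2S⁻¹`∕`toL2⁻¹` sups and the
# lit∕engine currency `WL2.equiv ℂ _ W₂ · y` of px13 g16's (B4)–(B6) ✓∕⧗`Prop7CurvedMemberLocalHessian.exists_curved_localHessian` (its `hNω hMu hMw` binders, made GLOBAL — the local rows
# follow by restriction).  SLOT-GENERIC (`Δx` abstract: the Π-road `DeltaPiSlotP a` and the J-road `DeltaOneP a T_J` read the same file).  (width seat `ym3-torus-px21` g16; ★p1 g28 CHAIR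
# WORD №46 (2) «H1+H3 — px21 g16 ∕ px17 g12 first refusal (S knit, one file)».)

Cell `ym3-torus` (HUMAN RULING D-0037; rung R3 = SU(2) YM₃ on T³ — NOT d = 4, NOT infinite volume, NOT a mass gap, NOT Clay).  THEOREMS ONLY (0 `def`, 0 `sorry`, default heartbeats);
`--supports stmt-QuantumFields-19200 --as helper`; count-neutral.

THE MATHEMATICS ([Balaban1985BackgroundPropagators] Thm 3.1 (3.42)∕(3.46), (3.21)–(3.25), (3.118)–(3.122)).  Nothing but composition of sup letters: `v := D*_{U₀}(G_{Δx}(toL2 A))` has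
`sup ≤ BD₁‖A‖` (Div1); `ω₁ = R_S v` has `sup ≤ C_R·√2·BD₁‖A‖` (`R_S` letter in the `W₂` fibre currency, `√2` = Frobenius vs operator norm ✓`norm_frobEquiv_symm_le`); `λ₁ = G′ᴾ(R_S v)`
has `sup ≤ C₁·BD₁‖A‖` (c1); `D_{U₀}λ₁` has `sup ≤ C₂·BD₁‖A‖` (c2); and `Δ^η_{U₀}λ₁ = ω₁` (`Δ₀P₀ = 0`).  These are the value inputs `N_ω M_u M_w` of print's Thm 3.1 (3.43)–(3.44) Schauder
mechanism for the covariant Hessian of `λ₁` (the H-ROAD's H4–H7); the ½-Hölder row `H_ω` of `ω₁` is brick (B2), NOT here.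

WHAT IS PROVED (ns `Summit.QuantumFields.YangMills.Theorems.Prop7StoreyHValueRows`; member `F n K`, `h : n ≤ K`, weights `c₀ cB > 0`, coupling `0 ≤ a`, abstract slot `Δx`).
* §1 currency: `norm_equiv_le_of_norm_symm_toL2S_le` (`‖toL2S⁻¹g x‖ ≤ m ∀x ⟹ ‖g y‖_{W₂} ≤ √2·m ∀y`), `norm_symm_toL2S_le_of_norm_equiv_le` (converse, constant `1`), and the bond twins
  `norm_equiv_le_of_norm_symm_toL2_le`, `norm_symm_toL2_le_of_norm_equiv_le`.
* §2 ★★★ `storeyH_value_rows` — at the letters `hD1` (Div1), `hR` (`R_S` sup, fibre currency), `hc1`, `hc2`: for every `A`, the FIVE rows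
  `∀ y, ‖ω₁ y‖_{W₂} ≤ (CR·(√2·BD₁))·‖A‖`, `∀ x, ‖toL2S⁻¹ λ₁ x‖ ≤ (C₁·BD₁)·‖A‖`, `∀ y, ‖λ₁ y‖_{W₂} ≤ (√2·(C₁·BD₁))·‖A‖`, `∀ b, ‖toL2⁻¹(D_{U₀}λ₁) b‖ ≤ (C₂·BD₁)·‖A‖`,
  `∀ q, ‖(D_{U₀}λ₁) q‖_{W₂} ≤ (√2·(C₂·BD₁))·‖A‖`; ★ `covLapSite_lambda₁_eq_omega₁` (the equation); ★★ `storeyH_local_value_rows` — the three `hNω hMu hMw` binders of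
  `exists_curved_localHessian` (ball-restricted, radii `4ℓ+2`, `4ℓ+1`, `4ℓ+2`) at `u := λ₁`, `ω := ω₁`, for every centre, by restriction.
HYP-SAT (★★OWNER RULING №42).  `hD1` ⟸ (O-G1) ✓p770606 ∕ E2E ✓p775116's own input (J-slot) or FILE C ✓p769116 (Π-slot), member∕K-free∕family by ✓p776018∕✓p776104; `hR` ⟸ ✓`norm_equiv_RS_le_pin`
(px5 g13) ∕ `…_of_letters`; `hc1 hc2` ⟸ ✓`norm_symm_GprimeP_RS_toL2S_le_pin` ∕ ✓`norm_symm_DL2_GprimeP_RS_toL2S_le_pin` (and px5's member∕of-lift editions).  Conclusions are explicit sup rows;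
nothing conclusion-shaped is assumed; no `Prop` placeholder.
HONEST SCOPE.  A knit of displayed sup letters (no estimate proved here); nothing of (B2), H4–H8, `h3`, `norm_G`, the EX rows, EX `stub_existenceMinimalOrbit`, 19200 or the rung is proved;
no summit is proved by a helper; the Yang–Mills mass gap is NOT proved.

References: T. Bałaban, CMP **99** (1985) 389–434 [Balaban1985BackgroundPropagators] ((3.21)–(3.25) p.394, Thm 3.1 (3.42)–(3.46) pp.397–398, (3.118)–(3.122) pp.419–420, (3.152)
p.426); CMP **102** (1985) 277–309 [Balaban1985Variational] ((117) p.295, (138)–(139) p.299).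
-/

set_option autoImplicit false

noncomputable section

open scoped Matrix.Norms.L2Operator BigOperators InnerProductSpace ComplexConjugate

namespace Summit.QuantumFields.YangMills.Theorems.Prop7StoreyHValueRows

open Literature.MathematicalPhysics.QuantumFieldTheory.Balaban1983to89
open Literature.MathematicalPhysics.QuantumFieldTheory.Balaban1983to89.T3ContinuumYM3Torus
open B4Sect5Torus (TSite tdist)
open B9SectCLatticeCarrier (Bond)
open B9Eq311L2Pairing (WL2)
open B11Eq103H1Complex (SiteL2K BondL2K)
open Summit.QuantumFields.YangMills.Theorems.Prop7SectET3Transport (periodsT3 siteEquiv bondEquiv)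
open Summit.QuantumFields.YangMills.Theorems.Prop7SectET3HilbertLetters (W₂ frobEquiv toL2 toL2S DL2 DstarL2 covLapSite toL2_symm_apply toL2S_symm_apply)
open Summit.QuantumFields.YangMills.Theorems.Prop7SectET3GaugeProjector (RS)
open Summit.QuantumFields.YangMills.Theorems.Prop7SectET3CurvedPropagators (GT)
open Summit.QuantumFields.YangMills.Theorems.Prop7SectET3DeltaPiPInv (GprimeP)
open Summit.QuantumFields.YangMills.Theorems.Prop7RieszTauFrobNorm (norm_frobEquiv_le norm_frobEquiv_symm_le)
open Summit.QuantumFields.YangMills.Theorems.Prop7GreenOnPureGaugeSources (covLapSite_GprimeP_RS)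

variable (F : T3Family) {n K : ℕ} (h : n ≤ K) (c₀ cB : ℝ) [Fact (0 < c₀)] [Fact (0 < cB)]

/-! ## §1 Currency: route sups (`toL2S⁻¹`, `toL2⁻¹`, operator norm on `M₂(ℂ)`) versus fibre sups (`WL2.equiv … y`, the `W₂` norm) -/

omit [Fact (0 < c₀)] [Fact (0 < cB)] in
/-- `‖toL2S⁻¹g x‖ ≤ m` at every route site ⟹ `‖g y‖_{W₂} ≤ √2·m` at every torus site (✓`toL2S_symm_apply`, ✓`norm_frobEquiv_symm_le`). [cite: Balaban1985BackgroundPropagators, (3.11) p.392] -/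
theorem norm_equiv_le_of_norm_symm_toL2S_le (g : SiteL2K ℂ 3 (periodsT3 F K) c₀ W₂) {m : ℝ}
    (hg : ∀ x : Site (F.P K) 0, ‖(toL2S F K c₀).symm g x‖ ≤ m) (y : TSite 3 (periodsT3 F K)) :
    ‖WL2.equiv ℂ _ W₂ g y‖ ≤ Real.sqrt 2 * m := by
  have hx := hg ((siteEquiv F K).symm y)
  rw [toL2S_symm_apply, Equiv.apply_symm_apply] at hx
  have h1 : WL2.equiv ℂ _ W₂ g y = frobEquiv.symm (frobEquiv (WL2.equiv ℂ _ W₂ g y)) := (LinearEquiv.symm_apply_apply _ _).symm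
  rw [h1]
  exact (norm_frobEquiv_symm_le _).trans (mul_le_mul_of_nonneg_left hx (Real.sqrt_nonneg _))

omit [Fact (0 < c₀)] [Fact (0 < cB)] in
/-- `‖g y‖_{W₂} ≤ m` at every torus site ⟹ `‖toL2S⁻¹g x‖ ≤ m` at every route site (✓`toL2S_symm_apply`, ✓`norm_frobEquiv_le`). [cite: Balaban1985BackgroundPropagators, (3.11) p.392] -/
theorem norm_symm_toL2S_le_of_norm_equiv_le (g : SiteL2K ℂ 3 (periodsT3 F K) c₀ W₂) {m : ℝ}
    (hg : ∀ y : TSite 3 (periodsT3 F K), ‖WL2.equiv ℂ _ W₂ g y‖ ≤ m) (x : Site (F.P K) 0) :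
    ‖(toL2S F K c₀).symm g x‖ ≤ m := by
  rw [toL2S_symm_apply]
  exact (norm_frobEquiv_le _).trans (hg _)

omit [Fact (0 < c₀)] [Fact (0 < cB)] in
/-- Bond twin: `‖toL2⁻¹f b‖ ≤ m` at every route bond ⟹ `‖f q‖_{W₂} ≤ √2·m` at every torus bond. [cite: Balaban1985BackgroundPropagators, (3.11) p.392] -/
theorem norm_equiv_le_of_norm_symm_toL2_le (f : BondL2K ℂ 3 (periodsT3 F K) c₀ W₂) {m : ℝ}
    (hf : ∀ b : PBond (F.P K) 0, ‖(toL2 F K c₀).symm f b‖ ≤ m) (q : Bond 3 (periodsT3 F K)) :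
    ‖WL2.equiv ℂ _ W₂ f q‖ ≤ Real.sqrt 2 * m := by
  have hb := hf ((bondEquiv F K).symm q)
  rw [toL2_symm_apply, Equiv.apply_symm_apply] at hb
  have h1 : WL2.equiv ℂ _ W₂ f q = frobEquiv.symm (frobEquiv (WL2.equiv ℂ _ W₂ f q)) := (LinearEquiv.symm_apply_apply _ _).symm
  rw [h1]
  exact (norm_frobEquiv_symm_le _).trans (mul_le_mul_of_nonneg_left hb (Real.sqrt_nonneg _))

omit [Fact (0 < c₀)] [Fact (0 < cB)] in
/-- Bond twin: `‖f q‖_{W₂} ≤ m` at every torus bond ⟹ `‖toL2⁻¹f b‖ ≤ m` at every route bond. [cite: Balaban1985BackgroundPropagators, (3.11) p.392] -/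
theorem norm_symm_toL2_le_of_norm_equiv_le (f : BondL2K ℂ 3 (periodsT3 F K) c₀ W₂) {m : ℝ}
    (hf : ∀ q : Bond 3 (periodsT3 F K), ‖WL2.equiv ℂ _ W₂ f q‖ ≤ m) (b : PBond (F.P K) 0) :
    ‖(toL2 F K c₀).symm f b‖ ≤ m := by
  rw [toL2_symm_apply]
  exact (norm_frobEquiv_le _).trans (hf _)

/-! ## §2 H1 + H3: the value rows of `ω₁`, `λ₁`, `D_{U₀}λ₁`, and the equation -/

variable {a : ℝ} (Δx : GaugeField (F.P K) 0 (Matrix.specialUnitaryGroup (Fin 2) ℂ) → (BondL2K ℂ 3 (periodsT3 F K) c₀ W₂ →ₗ[ℂ] BondL2K ℂ 3 (periodsT3 F K) c₀ W₂))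
  (U₀ : GaugeField (F.P K) 0 (Matrix.specialUnitaryGroup (Fin 2) ℂ))

/-- ★ **THE SLICE-ENGINE EQUATION `Δ^η_{U₀}λ₁ = ω₁`** for `λ₁ = G′ᴾ_a(R_S(D*_{U₀}(G_{Δx}x)))`, `ω₁ = R_S(D*_{U₀}(G_{Δx}x))` — ✓`covLapSite_GprimeP_RS` (`Δ₀P₀ = 0`) at this source; the
`covLapSite … = ω` hypothesis of ✓∕⧗`exists_curved_localHessian` (H4–H6). [cite: Balaban1985BackgroundPropagators, (3.22)–(3.25) p.394] -/
theorem covLapSite_lambda₁_eq_omega₁ (ha : 0 ≤ a) (x : BondL2K ℂ 3 (periodsT3 F K) c₀ W₂) :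
    covLapSite F n K c₀ U₀ (GprimeP F n K h c₀ cB a U₀ (RS F n K h c₀ cB U₀ (DstarL2 F n K c₀ U₀ (GT F n K h c₀ cB a Δx U₀ x))))
      = RS F n K h c₀ cB U₀ (DstarL2 F n K c₀ U₀ (GT F n K h c₀ cB a Δx U₀ x)) :=
  covLapSite_GprimeP_RS (h := h) (cB := cB) ha U₀ _

/-- ★★★ **H1 + H3: THE VALUE ROWS OF `ω₁`, `λ₁`, `D_{U₀}λ₁`, LINEAR IN `‖A‖`** — at the letters (Div1) `hD1` (the divergence sup row of `G_{Δx}`), `hR` (the `R_S` sup letter, fibre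
currency — px5's (c)-package text), (c1) `hc1`, (c2) `hc2` (FILE C's texts): for every bond field `A`, with `v := D*_{U₀}(G_{Δx}(toL2 A))`, `ω₁ := R_S v`, `λ₁ := G′ᴾ_a(ω₁)`:
(N_ω) `‖ω₁ y‖_{W₂} ≤ (CR·(√2·BD₁))·‖A‖`; (M_u) `‖toL2S⁻¹λ₁ x‖ ≤ (C₁·BD₁)·‖A‖` and `‖λ₁ y‖_{W₂} ≤ (√2·(C₁·BD₁))·‖A‖`; (M_w) `‖toL2⁻¹(D_{U₀}λ₁) b‖ ≤ (C₂·BD₁)·‖A‖` and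
`‖(D_{U₀}λ₁) q‖_{W₂} ≤ (√2·(C₂·BD₁))·‖A‖` — print's Thm 3.1 value inputs for the Hessian of `λ₁` (STOREY H bricks (B1)(B3)).
[cite: Balaban1985BackgroundPropagators, (3.21)–(3.25) p.394, Thm 3.1 (3.42)–(3.46) pp.397–398, (3.118)–(3.122) pp.419–420; Balaban1985Variational, (117) p.295] -/
theorem storeyH_value_rows {BD₁ CR C₁ C₂ : ℝ}
    (hD1 : ∀ (A : PBond (F.P K) 0 → Matrix (Fin 2) (Fin 2) ℂ) (x : Site (F.P K) 0),
      ‖(toL2S F K c₀).symm (DstarL2 F n K c₀ U₀ (GT F n K h c₀ cB a Δx U₀ (toL2 F K c₀ A))) x‖ ≤ BD₁ * ‖A‖)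
    (hR : ∀ (g : SiteL2K ℂ 3 (periodsT3 F K) c₀ W₂) (Gb : ℝ), (∀ y, ‖WL2.equiv ℂ _ W₂ g y‖ ≤ Gb) → ∀ y, ‖WL2.equiv ℂ _ W₂ (RS F n K h c₀ cB U₀ g) y‖ ≤ CR * Gb)
    (hc1 : ∀ (v : Site (F.P K) 0 → Matrix (Fin 2) (Fin 2) ℂ) (m : ℝ), (∀ x, ‖v x‖ ≤ m) →
      ∀ x, ‖(toL2S F K c₀).symm (GprimeP F n K h c₀ cB a U₀ (RS F n K h c₀ cB U₀ (toL2S F K c₀ v))) x‖ ≤ C₁ * m)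
    (hc2 : ∀ (v : Site (F.P K) 0 → Matrix (Fin 2) (Fin 2) ℂ) (m : ℝ), (∀ x, ‖v x‖ ≤ m) →
      ∀ b, ‖(toL2 F K c₀).symm (DL2 F n K c₀ U₀ (GprimeP F n K h c₀ cB a U₀ (RS F n K h c₀ cB U₀ (toL2S F K c₀ v)))) b‖ ≤ C₂ * m)
    (A : PBond (F.P K) 0 → Matrix (Fin 2) (Fin 2) ℂ) :
    (∀ y : TSite 3 (periodsT3 F K),
        ‖WL2.equiv ℂ _ W₂ (RS F n K h c₀ cB U₀ (DstarL2 F n K c₀ U₀ (GT F n K h c₀ cB a Δx U₀ (toL2 F K c₀ A)))) y‖ ≤ (CR * (Real.sqrt 2 * BD₁)) * ‖A‖) ∧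
    (∀ x : Site (F.P K) 0,
        ‖(toL2S F K c₀).symm (GprimeP F n K h c₀ cB a U₀ (RS F n K h c₀ cB U₀ (DstarL2 F n K c₀ U₀ (GT F n K h c₀ cB a Δx U₀ (toL2 F K c₀ A))))) x‖ ≤ (C₁ * BD₁) * ‖A‖) ∧
    (∀ y : TSite 3 (periodsT3 F K),
        ‖WL2.equiv ℂ _ W₂ (GprimeP F n K h c₀ cB a U₀ (RS F n K h c₀ cB U₀ (DstarL2 F n K c₀ U₀ (GT F n K h c₀ cB a Δx U₀ (toL2 F K c₀ A))))) y‖ ≤ (Real.sqrt 2 * (C₁ * BD₁)) * ‖A‖) ∧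
    (∀ b : PBond (F.P K) 0,
        ‖(toL2 F K c₀).symm (DL2 F n K c₀ U₀ (GprimeP F n K h c₀ cB a U₀ (RS F n K h c₀ cB U₀ (DstarL2 F n K c₀ U₀ (GT F n K h c₀ cB a Δx U₀ (toL2 F K c₀ A)))))) b‖ ≤ (C₂ * BD₁) * ‖A‖) ∧
    (∀ q : Bond 3 (periodsT3 F K),
        ‖WL2.equiv ℂ _ W₂ (DL2 F n K c₀ U₀ (GprimeP F n K h c₀ cB a U₀ (RS F n K h c₀ cB U₀ (DstarL2 F n K c₀ U₀ (GT F n K h c₀ cB a Δx U₀ (toL2 F K c₀ A)))))) q‖ ≤ (Real.sqrt 2 * (C₂ * BD₁)) * ‖A‖) := by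
  -- the source `v = D*G x` read as a route site function `v'` with `toL2S v' = v`
  set v := DstarL2 F n K c₀ U₀ (GT F n K h c₀ cB a Δx U₀ (toL2 F K c₀ A)) with hv
  set v' : Site (F.P K) 0 → Matrix (Fin 2) (Fin 2) ℂ := (toL2S F K c₀).symm v with hv'
  have hvv : toL2S F K c₀ v' = v := LinearEquiv.apply_symm_apply _ _
  have hv'le : ∀ x, ‖v' x‖ ≤ BD₁ * ‖A‖ := fun x => hD1 A x
  -- (N_ω): fibre sup of `v`, then the `R_S` letter
  have hvfib : ∀ y, ‖WL2.equiv ℂ _ W₂ v y‖ ≤ Real.sqrt 2 * (BD₁ * ‖A‖) := norm_equiv_le_of_norm_symm_toL2S_le F c₀ v hv'le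
  have hN : ∀ y, ‖WL2.equiv ℂ _ W₂ (RS F n K h c₀ cB U₀ v) y‖ ≤ (CR * (Real.sqrt 2 * BD₁)) * ‖A‖ := fun y =>
    (hR v _ hvfib y).trans_eq (by ring)
  -- (M_u): (c1) on `v'`
  have hMu : ∀ x, ‖(toL2S F K c₀).symm (GprimeP F n K h c₀ cB a U₀ (RS F n K h c₀ cB U₀ v)) x‖ ≤ (C₁ * BD₁) * ‖A‖ := fun x => by
    have h1 := hc1 v' _ hv'le x
    rw [hvv] at h1
    exact h1.trans_eq (by ring)
  -- (M_w): (c2) on `v'`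
  have hMw : ∀ b, ‖(toL2 F K c₀).symm (DL2 F n K c₀ U₀ (GprimeP F n K h c₀ cB a U₀ (RS F n K h c₀ cB U₀ v))) b‖ ≤ (C₂ * BD₁) * ‖A‖ := fun b => by
    have h1 := hc2 v' _ hv'le b
    rw [hvv] at h1
    exact h1.trans_eq (by ring)
  exact ⟨hN, hMu, fun y => (norm_equiv_le_of_norm_symm_toL2S_le F c₀ _ hMu y).trans_eq (by ring), hMw,
    fun q => (norm_equiv_le_of_norm_symm_toL2_le F c₀ _ hMw q).trans_eq (by ring)⟩

/-- ★★ **THE THREE LOCAL VALUE BINDERS `hNω hMu hMw` OF THE HESSIAN ENGINE, BY RESTRICTION** — for every centre `x₀`: the ball-restricted rows of ✓∕⧗`exists_curved_localHessian`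
(radii `4ℓ+2`, `4ℓ+1`, `4ℓ+2`) at `ω := ω₁`, `u := λ₁`, with `Nω := (CR·(√2·BD₁))·‖A‖`, `Mu := (√2·(C₁·BD₁))·‖A‖`, `Mw := (√2·(C₂·BD₁))·‖A‖`.
[cite: Balaban1985BackgroundPropagators, Thm 3.1 (3.43)–(3.44) p.398, (3.118)–(3.122) pp.419–420] -/
theorem storeyH_local_value_rows {BD₁ CR C₁ C₂ : ℝ}
    (hD1 : ∀ (A : PBond (F.P K) 0 → Matrix (Fin 2) (Fin 2) ℂ) (x : Site (F.P K) 0),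
      ‖(toL2S F K c₀).symm (DstarL2 F n K c₀ U₀ (GT F n K h c₀ cB a Δx U₀ (toL2 F K c₀ A))) x‖ ≤ BD₁ * ‖A‖)
    (hR : ∀ (g : SiteL2K ℂ 3 (periodsT3 F K) c₀ W₂) (Gb : ℝ), (∀ y, ‖WL2.equiv ℂ _ W₂ g y‖ ≤ Gb) → ∀ y, ‖WL2.equiv ℂ _ W₂ (RS F n K h c₀ cB U₀ g) y‖ ≤ CR * Gb)
    (hc1 : ∀ (v : Site (F.P K) 0 → Matrix (Fin 2) (Fin 2) ℂ) (m : ℝ), (∀ x, ‖v x‖ ≤ m) →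
      ∀ x, ‖(toL2S F K c₀).symm (GprimeP F n K h c₀ cB a U₀ (RS F n K h c₀ cB U₀ (toL2S F K c₀ v))) x‖ ≤ C₁ * m)
    (hc2 : ∀ (v : Site (F.P K) 0 → Matrix (Fin 2) (Fin 2) ℂ) (m : ℝ), (∀ x, ‖v x‖ ≤ m) →
      ∀ b, ‖(toL2 F K c₀).symm (DL2 F n K c₀ U₀ (GprimeP F n K h c₀ cB a U₀ (RS F n K h c₀ cB U₀ (toL2S F K c₀ v)))) b‖ ≤ C₂ * m)
    (A : PBond (F.P K) 0 → Matrix (Fin 2) (Fin 2) ℂ) (x₀ : TSite 3 (periodsT3 F K)) :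
    (∀ y, tdist (periodsT3 F K) x₀ y ≤ 4 * (F.L : ℝ) ^ (K - n) + 2 →
        ‖WL2.equiv ℂ (fun _ : TSite 3 (periodsT3 F K) => c₀) W₂ (RS F n K h c₀ cB U₀ (DstarL2 F n K c₀ U₀ (GT F n K h c₀ cB a Δx U₀ (toL2 F K c₀ A)))) y‖
          ≤ (CR * (Real.sqrt 2 * BD₁)) * ‖A‖) ∧
    (∀ y, tdist (periodsT3 F K) x₀ y ≤ 4 * (F.L : ℝ) ^ (K - n) + 1 →
        ‖WL2.equiv ℂ (fun _ : TSite 3 (periodsT3 F K) => c₀) W₂ (GprimeP F n K h c₀ cB a U₀ (RS F n K h c₀ cB U₀ (DstarL2 F n K c₀ U₀ (GT F n K h c₀ cB a Δx U₀ (toL2 F K c₀ A))))) y‖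
          ≤ (Real.sqrt 2 * (C₁ * BD₁)) * ‖A‖) ∧
    (∀ (y : TSite 3 (periodsT3 F K)) (κ : Fin 3), tdist (periodsT3 F K) x₀ y ≤ 4 * (F.L : ℝ) ^ (K - n) + 2 →
        ‖WL2.equiv ℂ (fun _ : Bond 3 (periodsT3 F K) => c₀) W₂
            (DL2 F n K c₀ U₀ (GprimeP F n K h c₀ cB a U₀ (RS F n K h c₀ cB U₀ (DstarL2 F n K c₀ U₀ (GT F n K h c₀ cB a Δx U₀ (toL2 F K c₀ A)))))) (y, κ)‖
          ≤ (Real.sqrt 2 * (C₂ * BD₁)) * ‖A‖) := by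
  obtain ⟨hN, -, hMu, -, hMw⟩ := storeyH_value_rows F h c₀ cB Δx U₀ hD1 hR hc1 hc2 A
  exact ⟨fun y _ => hN y, fun y _ => hMu y, fun y κ _ => hMw (y, κ)⟩

end Summit.QuantumFields.YangMills.Theorems.Prop7StoreyHValueRows

end
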